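import Summits.Schanuel.Schanuel.Theorems.RootDecomp1EGenericScale03

/-!
# RootDecomp1EGenericScale — lens 2, generation 38 «GENERIC-SCALE INDUCTION STEP» (kernel: radical descent over an arbitrary type function; cells below the E-R19 floor) — continuation (RootDecomp1EGenericScale04): `algebraicIndependent_radical_generic` + §4 plumbing (`exists_finset_algebraicIndependent_maximal_mem`, `trdeg_adjoin_le_card`, `coordFamily`, `lt_of_notMem_range`, `defect_step`)

(lens-2 g38 `GenericScale.lean` EDITION 2 [HOME/decomp-schanuel-lens-2/g38/GenericScale.lean EDITION 2 sha256 cf4f06e4…1307, 1762 l (ed.1 b58a0d29…; proof-only reshape `type_clash`, NOTE/EDITION2 L1842, writer re-check L1845) + GenericScaleCtrl ed.2 84ae4551… + NODE-g38.md ffd0a60c…; NODE L1822 / REQUEST L1823; critic ACK + OBJECTION L1800, VERDICT L1833]; port by census-1 gen 16 in six parts — see the PORT NOTE of part 01; `--supports stmt-Schanuel-31409`; rung 0.)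
-/

noncomputable section

open Complex

namespace Summit.Schanuel.Schanuel.Theorems.RootDecomp1EGenericScale

open MvPolynomial
open Summit.Schanuel.Schanuel.Theorems.RootDecomp1KHyper (mvlen mvlen_nonneg abs_coeff_le_mvlen one_le_mvlen
  exists_ball_eval_ne_zero)
open Summit.Schanuel.Schanuel.Theorems.RootDecomp1BRadicalDescent

section Kernel

variable {n : ℕ}

/-- **The kernel for an algebraically independent tuple and its own type function**: no
Diophantine input on `θ` at all — `ρ` type-Liouville relative to `relTypeFn v` for ANY tuple `v`
of which `θ` is an algebraically independent coordinate sub-family. -/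
theorem algebraicIndependent_radical_generic {N k : ℕ} (v : Fin N → ℂ) (f : Fin k → Fin N)
    (hf : Function.Injective f) (hθ : AlgebraicIndependent ℚ (v ∘ f)) (i₀ : Fin k) {y₀ : ℂ}
    (hy : cexp y₀ = v (f i₀)) {ρ : ℝ} (hρ : TypeLiouville (relTypeFn v) ρ) (hρ0 : 0 < ρ) :
    AlgebraicIndependent ℚ
      (Fin.cons (cexp ((ρ : ℂ) * y₀)) (Fin.cons (ρ : ℂ) (v ∘ f)) : Fin (k + 2) → ℂ) :=
  algebraicIndependent_radical_of_type (fun D L => (relTypeFn_pos v D L).le) (relTypeFn_le_one v)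
    (fun _ _ _ _ hD hL => relTypeFn_anti v hD hL) (relTypeFn_le_of_subfamily v f hf hθ) i₀ hy hρ hρ0

end Kernel

/-! ## §4 Plumbing: anchored maximal algebraically independent coordinate sets, `trdeg ≤ #S` -/

section Plumbing

open scoped IntermediateField.algebraAdjoinAdjoin

/-- A maximal algebraically independent sub-family of the coordinates of a point THROUGH a given
transcendental coordinate `j₀`; every coordinate is algebraic over the ℚ-algebra it generates.
(Anchored variant of `Literature.NumberTheory.Transcendental.TrdegZariskiDim.
exists_finset_algebraicIndependent_maximal`, same proof.) -/
theorem exists_finset_algebraicIndependent_maximal_mem {ι : Type} [Fintype ι] (P : ι → ℂ) (j₀ : ι)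
    (hj₀ : Transcendental ℚ (P j₀)) :
    ∃ S : Finset ι, j₀ ∈ S ∧ AlgebraicIndependent ℚ (fun i : S => P i) ∧
      ∀ j, IsAlgebraic (Algebra.adjoin ℚ (Set.range fun i : S => P i)) (P j) := by
  classical
  let good : Finset ι → Prop := fun S => j₀ ∈ S ∧ AlgebraicIndependent ℚ (fun i : S => P i)
  have hgood0 : good {j₀} := by
    refine ⟨Finset.mem_singleton_self _, ?_⟩
    haveI : Unique {i // i ∈ ({j₀} : Finset ι)} :=
      { default := ⟨j₀, Finset.mem_singleton_self _⟩
        uniq := fun i => Subtype.ext (Finset.mem_singleton.mp i.2) }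
    refine algebraicIndependent_unique_type_iff.mpr ?_
    have hd : ((default : {i // i ∈ ({j₀} : Finset ι)}) : ι) = j₀ :=
      Finset.mem_singleton.mp (default : {i // i ∈ ({j₀} : Finset ι)}).2
    show Transcendental ℚ (P ((default : {i // i ∈ ({j₀} : Finset ι)}) : ι))
    rw [hd]; exact hj₀
  have hne : ((Finset.univ : Finset (Finset ι)).filter good).Nonempty :=
    ⟨{j₀}, by simpa using hgood0⟩
  obtain ⟨S, hS, hmax⟩ := Finset.exists_max_image _ Finset.card hne
  simp only [Finset.mem_filter, Finset.mem_univ, true_and] at hS hmax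
  refine ⟨S, hS.1, hS.2, fun j => ?_⟩
  by_contra htr
  have hopt : AlgebraicIndependent ℚ (fun o : Option S => o.elim (P j) (fun i : S => P i)) :=
    (hS.2.option_iff_transcendental (P j)).mpr htr
  have hjS : j ∉ S := by
    intro hj
    exact htr (isAlgebraic_algebraMap
      (⟨P j, Algebra.subset_adjoin ⟨⟨j, hj⟩, rfl⟩⟩ : Algebra.adjoin ℚ (Set.range fun i : S => P i)))
  let f : {i // i ∈ insert j S} → Option S := fun i =>
    if h : (i : ι) ∈ S then some ⟨i, h⟩ else none
  have hf_of_not : ∀ i : {i // i ∈ insert j S}, (i : ι) ∉ S → (i : ι) = j := fun i hi => by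
    have := i.2
    rw [Finset.mem_insert] at this
    tauto
  have hf : Function.Injective f := by
    intro a b hab
    by_cases ha : (a : ι) ∈ S <;> by_cases hb : (b : ι) ∈ S
    · simp only [f, ha, hb, dif_pos, Option.some.injEq, Subtype.mk.injEq] at hab
      exact Subtype.ext hab
    · simp [f, ha, hb] at hab
    · simp [f, ha, hb] at hab
    · exact Subtype.ext ((hf_of_not a ha).trans (hf_of_not b hb).symm)
  have hgood : good (insert j S) := by
    refine ⟨Finset.mem_insert_of_mem hS.1, ?_⟩
    have hcomp := hopt.comp f hf
    have hfun : ((fun o : Option S => o.elim (P j) (fun i : S => P i)) ∘ f) =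
        fun i : {i // i ∈ insert j S} => P i := by
      funext i
      by_cases h : (i : ι) ∈ S
      · simp [f, h]
      · simp [f, hf_of_not i h, hjS]
    simpa only [hfun] using hcomp
  have := hmax _ hgood
  rw [Finset.card_insert_of_notMem hjS] at this
  omega

/-- With `S` as above, `trdeg_ℚ ℚ(P) ≤ #S`. (Verbatim copy of `Literature.NumberTheory.Transcendental.
TrdegZariskiDim.trdeg_adjoin_le_card` — copied, not imported, only because that module was not built on
the farm at the time of writing.) [folklore] -/
private theorem trdeg_adjoin_le_card {ι : Type} (P : ι → ℂ) (S : Finset ι)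
    (halg : ∀ j, IsAlgebraic (Algebra.adjoin ℚ (Set.range fun i : S => P i)) (P j)) :
    Algebra.trdeg ℚ (IntermediateField.adjoin ℚ (Set.range P)) ≤ S.card := by
  classical
  set x : S → ℂ := fun i => P i with hx
  set T : Set ℂ := Set.range x with hT
  let R₀ : Subalgebra ℚ ℂ := Algebra.adjoin ℚ T
  let E₀ : IntermediateField ℚ ℂ := IntermediateField.adjoin ℚ T
  let E : IntermediateField ℚ ℂ := IntermediateField.adjoin ℚ (Set.range P)
  have halgE₀ : ∀ j, IsAlgebraic E₀ (P j) := fun j =>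
    IntermediateField.isAlgebraic_adjoin_iff.mpr (halg j)
  have hEle : E ≤ (algebraicClosure E₀ ℂ).restrictScalars ℚ := by
    refine IntermediateField.adjoin_le_iff.mpr ?_
    rintro _ ⟨j, rfl⟩
    exact mem_algebraicClosure_iff.mpr (halgE₀ j)
  have halgR₀ : ∀ e : E, IsAlgebraic R₀ (e : ℂ) := fun e =>
    (IsFractionRing.isAlgebraic_iff R₀ E₀ ℂ).mpr (mem_algebraicClosure_iff.mp (hEle e.2))
  have hmemE : ∀ i, P i ∈ E := fun i => IntermediateField.subset_adjoin _ _ ⟨i, rfl⟩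
  let y : S → E := fun a => ⟨P a, hmemE a⟩
  let sE : Set E := Set.range y
  let v : E →ₐ[ℚ] ℂ := (algebraMap E ℂ).toRatAlgHom
  have hvinj : Function.Injective v := (algebraMap E ℂ).injective
  have himage : (v : E → ℂ) '' sE = T := by
    apply Set.Subset.antisymm
    · rintro _ ⟨_, ⟨a, rfl⟩, rfl⟩
      exact ⟨a, rfl⟩
    · rintro _ ⟨a, rfl⟩
      exact ⟨y a, ⟨a, rfl⟩, rfl⟩
  have hmap : (Algebra.adjoin ℚ sE).map v = R₀ := by
    rw [AlgHom.map_adjoin, himage]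
  let e₁ : Algebra.adjoin ℚ sE ≃ₐ[ℚ] R₀ :=
    (Subalgebra.equivMapOfInjective _ v hvinj).trans (Subalgebra.equivOfEq _ _ hmap)
  have he₁ : ∀ r : Algebra.adjoin ℚ sE, ((e₁ r : R₀) : ℂ) = ((r : E) : ℂ) := fun r => by
    have h := Subalgebra.coe_equivMapOfInjective_apply (Algebra.adjoin ℚ sE) v hvinj r
    simp only [e₁, AlgEquiv.trans_apply, Subalgebra.equivOfEq_apply]
    rw [h]
    rfl
  haveI : Algebra.IsAlgebraic (Algebra.adjoin ℚ sE) E := by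
    refine ⟨fun e => ?_⟩
    refine IsAlgebraic.of_ringHom_of_comp_eq (f := e₁.toAlgHom.toRingHom) (g := algebraMap E ℂ)
      (halgR₀ e) e₁.surjective (algebraMap E ℂ).injective ?_
    ext r
    exact he₁ r
  calc Algebra.trdeg ℚ E ≤ Cardinal.mk sE := Algebra.IsAlgebraic.trdeg_le_cardinalMk ℚ sE
    _ ≤ Cardinal.mk S := Cardinal.mk_range_le
    _ = S.card := Cardinal.mk_coe_finset

variable {m : ℕ}

/-- the coordinate tuple `(w, e^w)` of an `m`-tuple, indexed by `Fin (m + m)` -/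
def coordFamily (w : Fin m → ℂ) : Fin (m + m) → ℂ := Sum.elim w (cexp ∘ w) ∘ finSumFinEquiv.symm

/-- `coordFamily` on the first block. -/
private theorem coordFamily_castAdd (w : Fin m → ℂ) (i : Fin m) : coordFamily w (Fin.castAdd m i) = w i := by
  simp only [coordFamily, Function.comp_apply, finSumFinEquiv_symm_apply_castAdd, Sum.elim_inl]

/-- `coordFamily` on the second block. -/
private theorem coordFamily_natAdd (w : Fin m → ℂ) (i : Fin m) :
    coordFamily w (Fin.natAdd m i) = cexp (w i) := by
  simp only [coordFamily, Function.comp_apply, finSumFinEquiv_symm_apply_natAdd, Sum.elim_inr]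

/-- The range of `coordFamily w` is `range w ∪ range (exp ∘ w)`. -/
private theorem range_coordFamily (w : Fin m → ℂ) :
    Set.range (coordFamily w) = Set.range w ∪ Set.range (cexp ∘ w) := by
  rw [coordFamily, finSumFinEquiv.symm.surjective.range_comp, Set.Sum.elim_range]

/-- an embedded sub-tuple with one more index outside its range is strictly shorter -/
theorem lt_of_notMem_range {n : ℕ} (ι : Fin m ↪ Fin n) (j : Fin n) (hj : j ∉ Set.range ι) : m < n := by
  classical
  have h1 : (insert j (Finset.univ.map ι)).card = m + 1 := by
    rw [Finset.card_insert_of_notMem, Finset.card_map, Finset.card_univ, Fintype.card_fin]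
    intro hmem
    obtain ⟨x, _, hx⟩ := Finset.mem_map.mp hmem
    exact hj ⟨x, hx⟩
  have h2 : (insert j (Finset.univ.map ι)).card ≤ n := by
    simpa using Finset.card_le_univ (insert j (Finset.univ.map ι))
  omega

/-- **THE INDUCTION STEP.** If the `m`-sub-tuple `w = z ∘ ι` has defect `≤ 1`
(`m ≤ trdeg ℚ(w, e^w) + 1` — the first-failure / induction hypothesis), `e^{w_{i₀}}` is transcendental
and `z j = ρ · w_{i₀}` with `ρ > 0` type-Liouville relative to the coordinate tuple `(w, e^w)`, then
`trdeg ℚ(z, e^z) ≥ m + 1`. -/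
theorem defect_step {n : ℕ} {z : Fin n → ℂ} (ι : Fin m ↪ Fin n) (j : Fin n) (i₀ : Fin m) {ρ : ℝ}
    (hzj : z j = (ρ : ℂ) * z (ι i₀)) (htr : Transcendental ℚ (cexp (z (ι i₀)))) (hρ0 : 0 < ρ)
    (hρ : TypeLiouville (relTypeFn (coordFamily (z ∘ ι))) ρ)
    (hIH : (m : Cardinal) ≤ Algebra.trdeg ℚ ↥(IntermediateField.adjoin ℚ
      (Set.range (z ∘ ι) ∪ Set.range (Complex.exp ∘ (z ∘ ι)))) + 1) :
    ((m + 1 : ℕ) : Cardinal) ≤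
      Algebra.trdeg ℚ ↥(IntermediateField.adjoin ℚ (Set.range z ∪ Set.range (Complex.exp ∘ z))) := by
  classical
  set w : Fin m → ℂ := z ∘ ι with hw
  set v : Fin (m + m) → ℂ := coordFamily w with hv
  -- anchored maximal a.i. coordinate set through e^{w i₀}
  have hvtr : Transcendental ℚ (v (Fin.natAdd m i₀)) := by rw [hv, coordFamily_natAdd]; exact htr
  obtain ⟨S, hSmem, hSai, hSalg⟩ := exists_finset_algebraicIndependent_maximal_mem v _ hvtr
  -- #S ≥ m − 1 from the induction hypothesis
  have htr_le := trdeg_adjoin_le_card v S hSalg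
  rw [hv, range_coordFamily w] at htr_le
  have hmS : m ≤ S.card + 1 := by
    have h1 : (m : Cardinal) ≤ (S.card : Cardinal) + 1 := hIH.trans (by gcongr)
    have h2 : (m : Cardinal) ≤ ((S.card + 1 : ℕ) : Cardinal) := by push_cast; exact h1
    exact_mod_cast h2
  -- reindex S as Fin k
  set k : ℕ := S.card with hk
  obtain ⟨eS, heS⟩ : ∃ eS : S ≃ Fin k, eS = S.equivFin := ⟨_, rfl⟩
  let f : Fin k → Fin (m + m) := fun i => (eS.symm i : S)
  have hf : Function.Injective f := fun a b h => eS.symm.injective (Subtype.ext h)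
  have hθ : AlgebraicIndependent ℚ (v ∘ f) := hSai.comp _ eS.symm.injective
  set i₁ : Fin k := eS ⟨Fin.natAdd m i₀, hSmem⟩ with hi₁
  have hfi₁ : f i₁ = Fin.natAdd m i₀ := by simp [f, hi₁]
  have hy : cexp (z (ι i₀)) = v (f i₁) := by rw [hfi₁, hv, coordFamily_natAdd]; rfl
  -- the kernel
  have hai := algebraicIndependent_radical_generic v f hf hθ i₁ hy hρ hρ0
  -- count inside F = ℚ(z, e^z)
  set F := IntermediateField.adjoin ℚ (Set.range z ∪ Set.range (Complex.exp ∘ z)) with hF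
  have hzF : ∀ i, z i ∈ F := fun i => IntermediateField.subset_adjoin _ _ (Or.inl ⟨i, rfl⟩)
  have hezF : ∀ i, cexp (z i) ∈ F := fun i => IntermediateField.subset_adjoin _ _ (Or.inr ⟨i, rfl⟩)
  have hvF : ∀ l, v l ∈ F := by
    intro l
    have : v l ∈ Set.range w ∪ Set.range (cexp ∘ w) := by
      rw [← range_coordFamily w]; exact ⟨l, rfl⟩
    rcases this with ⟨i, hi⟩ | ⟨i, hi⟩
    · rw [← hi]; exact hzF (ι i)
    · rw [← hi]; exact hezF (ι i)
  have hz0 : z (ι i₀) ≠ 0 := by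
    intro h0
    apply htr
    rw [h0, Complex.exp_zero]
    exact isAlgebraic_one
  have hρF : (ρ : ℂ) ∈ F := by
    have : (ρ : ℂ) = z j / z (ι i₀) := by rw [hzj, mul_div_assoc, div_self hz0, mul_one]
    rw [this]; exact div_mem (hzF j) (hzF _)
  have heF : cexp ((ρ : ℂ) * z (ι i₀)) ∈ F := by rw [← hzj]; exact hezF j
  have hmem : ∀ i, (Fin.cons (cexp ((ρ : ℂ) * z (ι i₀))) (Fin.cons (ρ : ℂ) (v ∘ f)) :
      Fin (k + 2) → ℂ) i ∈ F := by
    intro i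
    refine Fin.cases ?_ (fun i' => Fin.cases ?_ (fun l => ?_) i') i
    · simpa using heF
    · simpa using hρF
    · simpa using hvF (f l)
  have hcard := RootDecomp1BDefectFloorCells.natCast_le_trdeg_of_algebraicIndependent hai hmem
  have hmk : m + 1 ≤ k + 2 := by omega
  calc ((m + 1 : ℕ) : Cardinal) ≤ ((k + 2 : ℕ) : Cardinal) := by exact_mod_cast hmk
    _ ≤ _ := hcard

end Plumbing

end Summit.Schanuel.Schanuel.Theorems.RootDecomp1EGenericScale

end
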